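import Summits.QuantumFields.YangMills.Theorems.ChatterjeeMassGapTorusAxialFreeLinkResample
import Literature.MathematicalPhysics.QuantumLattice.HeatKernelGroupConvolutionProofs
import HarnessLib

/-!
# S28ᵀ (Chatterjee torus-axial mass gap) — (O2) for every compact gauge group, I:
MERGE with a general kernel and the convolution powers of a class function
(ym-idea-4 g7, LINE-18)

Bears on rung S28ᵀ through the fork `S28BoxBit.gapCore_eventually_of_boxCumulant` (LINE-10),
obligation (O2) `κ_□ ≠ 0`, now for an ARBITRARY compact group `G` and an arbitrary continuous
class function `φ` (no character orthogonality, no Peter–Weyl). LINE-16 glued the ten faces of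
`∂B` with the idempotent MERGE kernel `∫ φ(x g⁻¹) φ(g y) dg = c φ(x y)`, available only for
`G ≅ SU(N)`. Here the kernel is hypothesis-free:

* `integral_merge_kernel`, `integral_merge_kernel₂` — MERGE with a spectator for two face
  functions `f₁, f₂` and ANY kernel `K` with `∫ f₁(x g⁻¹) f₂(g y) dg = K(x y)` (one-link
  resampling, `S28FreeLinkResample`); the disc function changes at each merge;
* `kernel_right`, `kernel_left` — for `ψ, φ` (`ψ` a class function in the second) the kernel IS
  the tree's convolution `haarConv ψ φ (z) = ∫ ψ(z h⁻¹) φ(h) dh`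
  (`Literature.MathematicalPhysics.QuantumLattice.haarConv`, `HeatKernelGroupConvolutionProofs`),
  in either orientation of the shared link (right translation; inversion and left translation);
* `haarConv_class`, `haarConv_inv` — the convolution of (inversion-invariant) class functions is
  again one; associativity is the tree's `haarConv_haarConv` (Fubini on `G × G`);
* `conv_power_add` — for a sequence `P 0 = φ`, `P (k+1) = haarConv (P k) φ` of convolution
  powers: `haarConv (P a) (P b) = P (a + b + 1)`; `conv_power_double_at_one` —
  `P (2a+1)(1) = ‖P a‖²_{L²(G)}`;
* **`conv_power_nine_at_one_pos`** — if `φ ≢ 0` then `P 9 (1) = ‖P 4‖² > 0`: every convolution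
  power of a non-zero inversion-invariant class function is non-zero, because
  `P (2a+1)(1) = ‖P a‖²` and `P (k+1) ≡ 0` whenever `P k ≡ 0`.

Parts II–III glue the ten faces of `∂B` with these kernels (`∫ ∏_{f∈∂B} φ(U_f) dg_∞ = P 9 (1)`,
the tenth convolution power at the identity) and conclude `κ_□(G, ρ) > 0` for every compact `G`
and every continuous unitary `ρ` with non-constant `Re χ_ρ`.
No summit is proved here: general-`G` Haar algebra for the island (small-β) case of the S28ᵀ gap
core; (O1) of the fork remains open.
-/

noncomputable section

open MeasureTheory Filter Topology
open Literature.MathematicalPhysics.QuantumLattice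
open Literature.MathematicalPhysics.QuantumFieldTheory (zdHaar haarProbability)

namespace Summit.QuantumFields.YangMills.Theorems.S28BoxConv

open S28FreeLinkResample

variable {G : Type} [Group G] [TopologicalSpace G] [IsTopologicalGroup G]
  [CompactSpace G] [MeasurableSpace G] [BorelSpace G] [SecondCountableTopology G]
variable {d : ℕ}

/-! ## MERGE with a general kernel -/

/-- **MERGE with a spectator, general kernel.** If `∫_G f₁(x g⁻¹) f₂(g y) dg = K(x y)` for all
`x, y`, then for continuous `X`, `W`, `Y` not depending on the link `ℓ` and integrands
`F = f₁(X·U_ℓ⁻¹)·f₂(U_ℓ·W)·Y`, `F' = K(X·W)·Y` (pointwise): `∫ F dg_∞ = ∫ F' dg_∞`.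
[folklore] -/
theorem integral_merge_kernel (ℓ : ZdEdge d) {f₁ f₂ K : G → ℝ} (hf₁ : Continuous f₁)
    (hf₂ : Continuous f₂)
    (hK : ∀ x y : G, ∫ g, f₁ (x * g⁻¹) * f₂ (g * y) ∂haarProbability G = K (x * y))
    {X W : LGConfig d G → G} {Y F F' : LGConfig d G → ℝ} (hXc : Continuous X)
    (hWc : Continuous W) (hX : ∀ (U : LGConfig d G) (g : G), X (Function.update U ℓ g) = X U)
    (hW : ∀ (U : LGConfig d G) (g : G), W (Function.update U ℓ g) = W U) (hYc : Continuous Y)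
    (hY : ∀ (U : LGConfig d G) (g : G), Y (Function.update U ℓ g) = Y U)
    (hF : ∀ U : LGConfig d G, F U = f₁ (X U * (U ℓ)⁻¹) * f₂ (U ℓ * W U) * Y U)
    (hF' : ∀ U : LGConfig d G, K (X U * W U) * Y U = F' U) :
    ∫ U, F U ∂zdHaar d G = ∫ U, F' U ∂zdHaar d G := by
  have key := integral_mul_eq_integral_integral_update_mul ℓ
    (X := fun U : LGConfig d G => f₁ (X U * (U ℓ)⁻¹) * f₂ (U ℓ * W U)) (Y := Y)
    ((hf₁.comp (hXc.mul (continuous_apply ℓ).inv)).mul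
      (hf₂.comp ((continuous_apply ℓ).mul hWc))) hYc hY
  rw [integral_congr_ae (Eventually.of_forall hF), ← integral_congr_ae (Eventually.of_forall hF')]
  refine key.trans ?_
  refine integral_congr_ae (Eventually.of_forall fun U => ?_)
  beta_reduce
  simp only [Function.update_self, hX U, hW U]
  rw [hK (X U) (W U)]

/-- **MERGE with a spectator, the shared link inside both words, general kernel.** For class
functions `f₁`, `f₂`, `K` with `∫ f₁(x g⁻¹) f₂(g y) dg = K(x y)`, `ℓ`-independent continuous
`X₁ X₂ W₁ W₂ Y` and integrands `F = f₁(X₁·U_ℓ⁻¹·X₂)·f₂(W₁·U_ℓ·W₂)·Y`,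
`F' = K(X₁·W₂·W₁·X₂)·Y`: `∫ F dg_∞ = ∫ F' dg_∞`. [folklore] -/
theorem integral_merge_kernel₂ (ℓ : ZdEdge d) {f₁ f₂ K : G → ℝ} (hf₁ : Continuous f₁)
    (hf₂ : Continuous f₂) (hcl₁ : ∀ s t : G, f₁ (s * t) = f₁ (t * s))
    (hcl₂ : ∀ s t : G, f₂ (s * t) = f₂ (t * s)) (hclK : ∀ s t : G, K (s * t) = K (t * s))
    (hK : ∀ x y : G, ∫ g, f₁ (x * g⁻¹) * f₂ (g * y) ∂haarProbability G = K (x * y))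
    {X₁ X₂ W₁ W₂ : LGConfig d G → G} {Y F F' : LGConfig d G → ℝ}
    (hX₁c : Continuous X₁) (hX₂c : Continuous X₂) (hW₁c : Continuous W₁)
    (hW₂c : Continuous W₂)
    (hX₁ : ∀ (U : LGConfig d G) (g : G), X₁ (Function.update U ℓ g) = X₁ U)
    (hX₂ : ∀ (U : LGConfig d G) (g : G), X₂ (Function.update U ℓ g) = X₂ U)
    (hW₁ : ∀ (U : LGConfig d G) (g : G), W₁ (Function.update U ℓ g) = W₁ U)
    (hW₂ : ∀ (U : LGConfig d G) (g : G), W₂ (Function.update U ℓ g) = W₂ U)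
    (hYc : Continuous Y) (hY : ∀ (U : LGConfig d G) (g : G), Y (Function.update U ℓ g) = Y U)
    (hF : ∀ U : LGConfig d G,
      F U = f₁ (X₁ U * (U ℓ)⁻¹ * X₂ U) * f₂ (W₁ U * U ℓ * W₂ U) * Y U)
    (hF' : ∀ U : LGConfig d G, K (X₁ U * W₂ U * W₁ U * X₂ U) * Y U = F' U) :
    ∫ U, F U ∂zdHaar d G = ∫ U, F' U ∂zdHaar d G := by
  refine integral_merge_kernel ℓ hf₁ hf₂ hK (X := fun U => X₂ U * X₁ U)
    (W := fun U => W₂ U * W₁ U) (Y := Y) (hX₂c.mul hX₁c) (hW₂c.mul hW₁c)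
    (fun U g => by simp only [hX₁ U, hX₂ U]) (fun U g => by simp only [hW₁ U, hW₂ U]) hYc hY
    (fun U => ?_) fun U => ?_
  · rw [hF U, hcl₁ (X₁ U * (U ℓ)⁻¹) (X₂ U), mul_assoc (W₁ U), hcl₂ (W₁ U)]
    simp only [mul_assoc]
  · rw [← hF' U, ← hclK (X₂ U)]
    simp only [mul_assoc]

/-! ## The kernel is the convolution -/

omit [SecondCountableTopology G] in
/-- Disc as the `X`-word: `∫ ψ(x g⁻¹) φ(g y) dg = (ψ ⋆ φ)(x y) = haarConv ψ φ (x y)` (right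
translation by `y`). [folklore] -/
theorem kernel_right (ψ φ : G → ℝ) (x y : G) :
    ∫ g, ψ (x * g⁻¹) * φ (g * y) ∂haarProbability G = haarConv ψ φ (x * y) := by
  rw [haarConv_eq_integral_mul_inv,
    ← integral_mul_right_eq_self (fun g => ψ (x * g⁻¹) * φ (g * y)) y⁻¹]
  refine integral_congr_ae (Eventually.of_forall fun h => ?_)
  simp only [mul_inv_rev, inv_inv, mul_assoc, inv_mul_cancel, mul_one]

omit [SecondCountableTopology G] in
/-- Disc as the `W`-word: for a class function `ψ`, `∫ φ(x g⁻¹) ψ(g y) dg = haarConv ψ φ (x y)`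
(inversion and left translation of Haar measure). [folklore] -/
theorem kernel_left (ψ φ : G → ℝ) (hψ : ∀ s t : G, ψ (s * t) = ψ (t * s)) (x y : G) :
    ∫ g, φ (x * g⁻¹) * ψ (g * y) ∂haarProbability G = haarConv ψ φ (x * y) := by
  rw [haarConv_eq_integral_mul_inv,
    ← integral_inv_eq_self (fun g => φ (x * g⁻¹) * ψ (g * y)) (haarProbability G),
    ← integral_mul_left_eq_self _ x⁻¹]
  refine integral_congr_ae (Eventually.of_forall fun h => ?_)
  simp only [mul_inv_rev, inv_inv, mul_inv_cancel_left]
  rw [mul_assoc h⁻¹, hψ h⁻¹ (x * y), mul_comm]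

omit [SecondCountableTopology G] in
/-- The convolution of class functions is a class function (conjugation invariance of Haar
measure). [folklore] -/
theorem haarConv_class {ψ φ : G → ℝ} (hψ : ∀ s t : G, ψ (s * t) = ψ (t * s))
    (hφ : ∀ s t : G, φ (s * t) = φ (t * s)) (s t : G) :
    haarConv ψ φ (s * t) = haarConv ψ φ (t * s) := by
  rw [haarConv_eq_integral_mul_inv, haarConv_eq_integral_mul_inv]
  symm
  rw [← integral_mul_left_eq_self (fun h => ψ (t * s * h⁻¹) * φ h) s⁻¹,
    ← integral_mul_right_eq_self _ s]
  refine integral_congr_ae (Eventually.of_forall fun h => ?_)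
  simp only [mul_inv_rev, inv_inv, mul_assoc, mul_inv_cancel_left]
  rw [hφ s⁻¹, mul_inv_cancel_right, ← mul_assoc t, hψ (t * h⁻¹) s]

omit [SecondCountableTopology G] in
/-- The convolution of inversion-invariant class functions is inversion invariant. [folklore] -/
theorem haarConv_inv {ψ φ : G → ℝ} (hψ : ∀ s t : G, ψ (s * t) = ψ (t * s))
    (hψi : ∀ h : G, ψ h⁻¹ = ψ h) (hφi : ∀ h : G, φ h⁻¹ = φ h) (z : G) :
    haarConv ψ φ z⁻¹ = haarConv ψ φ z := by
  rw [haarConv_eq_integral_mul_inv, haarConv_eq_integral_mul_inv,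
    ← integral_inv_eq_self (fun h => ψ (z⁻¹ * h⁻¹) * φ h) (haarProbability G)]
  refine integral_congr_ae (Eventually.of_forall fun h => ?_)
  simp only [inv_inv, hφi]
  rw [show z⁻¹ * h = (h⁻¹ * z)⁻¹ by rw [mul_inv_rev, inv_inv], hψi, hψ]

omit [SecondCountableTopology G] in
/-- The convolution of continuous functions on the compact group is continuous
(`continuous_haarConv` of the tree, the second factor being Haar integrable). [folklore] -/
theorem haarConv_continuous {ψ φ : G → ℝ} (hψ : Continuous ψ) (hφ : Continuous φ) :
    Continuous (haarConv ψ φ) :=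
  continuous_haarConv hψ (hφ.integrable_of_hasCompactSupport (HasCompactSupport.of_compactSpace _))

/-! ## Convolution powers -/

omit [SecondCountableTopology G] in
/-- **Semigroup of convolution powers.** For `P 0 = φ`, `P (k+1) = haarConv (P k) φ` (all
continuous): `haarConv (P a) (P b) = P (a + b + 1)` (associativity `haarConv_haarConv` of the
tree). [folklore] -/
theorem conv_power_add [T2Space G] {φ : G → ℝ} {P : ℕ → G → ℝ} (hφ : Continuous φ)
    (hP0 : P 0 = φ) (hstep : ∀ k : ℕ, P (k + 1) = haarConv (P k) φ)
    (hPc : ∀ k, Continuous (P k)) (a b : ℕ) : haarConv (P a) (P b) = P (a + b + 1) := by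
  induction b with
  | zero => rw [hP0, Nat.add_zero, hstep]
  | succ b ih =>
    rw [hstep b, haarConv_haarConv (hPc a) (hPc b) hφ, ih,
      show a + (b + 1) + 1 = a + b + 1 + 1 by ring, hstep (a + b + 1)]

omit [SecondCountableTopology G] in
/-- Convolution powers of a class function are class functions. [folklore] -/
theorem conv_power_class {φ : G → ℝ} {P : ℕ → G → ℝ} (hcl : ∀ s t : G, φ (s * t) = φ (t * s))
    (hP0 : P 0 = φ) (hstep : ∀ k : ℕ, P (k + 1) = haarConv (P k) φ) (k : ℕ) (s t : G) :
    P k (s * t) = P k (t * s) := by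
  induction k generalizing s t with
  | zero => rw [hP0]; exact hcl s t
  | succ k ih => rw [hstep]; exact haarConv_class ih hcl s t

omit [SecondCountableTopology G] in
/-- Convolution powers of a continuous function are continuous. [folklore] -/
theorem conv_power_continuous {φ : G → ℝ} {P : ℕ → G → ℝ} (hφ : Continuous φ) (hP0 : P 0 = φ)
    (hstep : ∀ k : ℕ, P (k + 1) = haarConv (P k) φ) (k : ℕ) : Continuous (P k) := by
  induction k with
  | zero => rw [hP0]; exact hφ
  | succ k ih => rw [hstep]; exact haarConv_continuous ih hφ

omit [SecondCountableTopology G] in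
/-- Convolution powers of an inversion-invariant class function are inversion invariant.
[folklore] -/
theorem conv_power_inv {φ : G → ℝ} {P : ℕ → G → ℝ} (hcl : ∀ s t : G, φ (s * t) = φ (t * s))
    (hinv : ∀ h : G, φ h⁻¹ = φ h) (hP0 : P 0 = φ)
    (hstep : ∀ k : ℕ, P (k + 1) = haarConv (P k) φ) (k : ℕ) (z : G) : P k z⁻¹ = P k z := by
  induction k generalizing z with
  | zero => rw [hP0]; exact hinv z
  | succ k ih => rw [hstep]; exact haarConv_inv (conv_power_class hcl hP0 hstep k) ih hinv z

omit [SecondCountableTopology G] in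
/-- `P (2a+1)(1) = ‖P a‖²_{L²(G)}`. [folklore] -/
theorem conv_power_double_at_one [T2Space G] {φ : G → ℝ} {P : ℕ → G → ℝ} (hφ : Continuous φ)
    (hcl : ∀ s t : G, φ (s * t) = φ (t * s)) (hinv : ∀ h : G, φ h⁻¹ = φ h) (hP0 : P 0 = φ)
    (hstep : ∀ k : ℕ, P (k + 1) = haarConv (P k) φ) (a : ℕ) :
    P (a + a + 1) 1 = ∫ h, P a h ^ 2 ∂haarProbability G := by
  rw [← conv_power_add hφ hP0 hstep (conv_power_continuous hφ hP0 hstep) a a,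
    haarConv_apply_one_of_symm (conv_power_inv hcl hinv hP0 hstep a)]
  refine integral_congr_ae (Eventually.of_forall fun h => ?_)
  beta_reduce
  rw [sq]

omit [SecondCountableTopology G] in
/-- `ψ ≢ 0 ⇒ ∫ ψ² dg > 0` for continuous `ψ` (Haar measure charges open sets). [folklore] -/
theorem integral_sq_pos {ψ : G → ℝ} (hψ : Continuous ψ) (h0 : ∃ g, ψ g ≠ 0) :
    0 < ∫ h, ψ h ^ 2 ∂haarProbability G := by
  obtain ⟨g, hg⟩ := h0
  exact Continuous.integral_pos_of_hasCompactSupport_nonneg_nonzero (hψ.pow 2)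
    (HasCompactSupport.of_compactSpace _) (fun h => sq_nonneg (ψ h)) (x := g) (pow_ne_zero 2 hg)

omit [SecondCountableTopology G] in
/-- If `P a ≢ 0` then `P (2a+1)(1) = ‖P a‖² > 0`. [folklore] -/
theorem conv_power_double_pos [T2Space G] {φ : G → ℝ} {P : ℕ → G → ℝ} (hφ : Continuous φ)
    (hcl : ∀ s t : G, φ (s * t) = φ (t * s)) (hinv : ∀ h : G, φ h⁻¹ = φ h) (hP0 : P 0 = φ)
    (hstep : ∀ k : ℕ, P (k + 1) = haarConv (P k) φ) {a : ℕ} (ha : ∃ g, P a g ≠ 0) :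
    0 < P (a + a + 1) 1 := by
  rw [conv_power_double_at_one hφ hcl hinv hP0 hstep a]
  exact integral_sq_pos (conv_power_continuous hφ hP0 hstep a) ha

omit [SecondCountableTopology G] in
/-- If `P (k+1) ≢ 0` then `P k ≢ 0` (`P k ≡ 0 ⇒ haarConv (P k) φ ≡ 0`). [folklore] -/
theorem conv_power_ne_of_succ {φ : G → ℝ} {P : ℕ → G → ℝ}
    (hstep : ∀ k : ℕ, P (k + 1) = haarConv (P k) φ) {k : ℕ} (hk : ∃ g, P (k + 1) g ≠ 0) :
    ∃ g, P k g ≠ 0 := by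
  by_contra h
  simp only [not_exists, not_not] at h
  obtain ⟨g, hg⟩ := hk
  exact hg (by simp [hstep, haarConv_apply, h])

omit [SecondCountableTopology G] in
/-- **The tenth convolution power of a non-zero inversion-invariant continuous class function is
positive at the identity**: `P 9 (1) = ‖P 4‖² > 0`. Chain: `φ = P 0 ≢ 0 ⇒ P 1 (1) > 0 ⇒
P 3 (1) > 0 ⇒ P 7 (1) > 0 ⇒ P 7, P 6, P 5, P 4 ≢ 0 ⇒ P 9 (1) > 0`. [folklore] -/
theorem conv_power_nine_at_one_pos [T2Space G] {φ : G → ℝ} {P : ℕ → G → ℝ} (hφ : Continuous φ)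
    (hcl : ∀ s t : G, φ (s * t) = φ (t * s)) (hinv : ∀ h : G, φ h⁻¹ = φ h) (hP0 : P 0 = φ)
    (hstep : ∀ k : ℕ, P (k + 1) = haarConv (P k) φ) (h0 : ∃ g, φ g ≠ 0) : 0 < P 9 1 := by
  have ne_of_pos : ∀ {k : ℕ}, 0 < P k 1 → ∃ g, P k g ≠ 0 := fun h => ⟨1, h.ne'⟩
  have h0' : ∃ g, P 0 g ≠ 0 := by rw [hP0]; exact h0
  have h1 : 0 < P 1 1 := conv_power_double_pos hφ hcl hinv hP0 hstep (a := 0) h0'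
  have h3 : 0 < P 3 1 := conv_power_double_pos hφ hcl hinv hP0 hstep (a := 1) (ne_of_pos h1)
  have h7 : 0 < P 7 1 := conv_power_double_pos hφ hcl hinv hP0 hstep (a := 3) (ne_of_pos h3)
  have h6 := conv_power_ne_of_succ hstep (k := 6) (ne_of_pos h7)
  have h5 := conv_power_ne_of_succ hstep (k := 5) h6
  have h4 := conv_power_ne_of_succ hstep (k := 4) h5
  exact conv_power_double_pos hφ hcl hinv hP0 hstep (a := 4) h4

end Summit.QuantumFields.YangMills.Theorems.S28BoxConv
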